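import Summits.Ventures.YMGap.RobustBall.MassGapOnBall
import Summits.QuantumFields.BalabanUV.InfraRed.StrongCouplingPoincareWindow
import HarnessLib

/-!
# Venture YMGap, track ROBUST-BALL — certified `(β⋆, ε)` rows for `SU(2)`, `d = 4` (single-link door, `ℤ^4`)

HONEST FRAMING. WHAT THIS IS: a venture file (cell `pub-ymgap`, track Y2 ROBUST-BALL, seat rb-p1): the
CERTIFIED ROWS of the `ℤ^4` single-link ball theorem for `SU(2)` — for each listed Wilson coupling `β⋆_W`
and radius `ε`, the kernel checks, in exact rational arithmetic (Taylor majorant of `exp` with Lagrange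
remainder, rational majorants of `√3`, `√(2/3)`), the row-sum inequality of `MassGapOnBall.lean` and
concludes `MassGapOnBallZd 4 2 (β⋆_W/4) (2ε) ε R` for EVERY range `R`: every continuous link
perturbation of the `SU(2)` Wilson action at `β⋆_W` with oscillation load `≤ 2ε` and cross-Lipschitz
load `≤ ε` at every link (the one-parameter convention `‖W‖ ≤ ε` of the design / referee lineage R) has a
unique, exponentially clustering DLR state on `ℤ^4`. Two lineages of rows: (A) the Poincaré pair
`(c, v) = (2/3, 8/3)` valid at every `β_W` (`ρ = 6β_W e^{2ε} + √(2/3) e^{ε} ε`; rows agree with rb-ref's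
independent LINEAGE-R table to the last digit), (B) the SHARP pair `(2/3, 2)` valid for `β_W ≤ 1/6`
(`ρ = 3√3 β_W e^{2ε} + √(2/3) e^{ε} ε`, from the tree's hypothesis-free `integral_var_tilted_le`), which
gives the larger `ε`. WHAT THIS IS NOT: not the largest conceivable ball (the star door / quarter
modulus would go further, cruxes Y2-X2 / ds-4's transfer); `ε` is reported at `1/1000` granularity;
strong-coupling LATTICE statements only; no continuum, no Millennium claim.

## Rows (d = 4, SU(2), single-link door; `(β⋆_W, ε)`, convention `ε₀ = 2ε`, `ε₁ = ε`)

(A) `(1/40, .470) (1/20, .346) (1/16, .294) (1/12, .219) (1/10, .167) (1/8, .097) (3/20, .036)`;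
(B) `(1/20, .376) (1/16, .328) (1/12, .258) (1/10, .209) (1/8, .143) (3/20, .085) (1/6, .049)`.
-/

noncomputable section

open MeasureTheory ProbabilityTheory Real
open Literature.MathematicalPhysics.QuantumFieldTheory
open Literature.MathematicalPhysics.QuantumFieldTheory.Balaban1983to89.StrongCouplingKernelWindow
  (integral_sq_re_trace_su2_mul coef_sq_le abs_re_trace_su2_mul_le_opNorm)
open Literature.MathematicalPhysics.QuantumFieldTheory.Balaban1983to89.StrongCouplingVarianceWindow
  (pot integral_var_tilted_le)
open Summit.QuantumFields.BalabanUV.InfraRed.StrongCouplingPoincareDoorSUN (oneLinkPoincareSUN_two_sharp)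

namespace Summit.Ventures.YMGap.RobustBall

/-! ### Exact numeric majorants -/

/-- Taylor majorant of the exponential on `[0, 1]` with Lagrange remainder (Mathlib `Real.exp_bound`,
`n = 4`): `e^x ≤ 1 + x + x²/2 + x³/6 + (5/96) x⁴`. -/
theorem exp_le_taylor4 {x : ℝ} (h0 : 0 ≤ x) (h1 : x ≤ 1) :
    exp x ≤ 1 + x + x ^ 2 / 2 + x ^ 3 / 6 + 5 / 96 * x ^ 4 := by
  have h := Real.exp_bound (x := x) (by rwa [abs_of_nonneg h0]) (n := 4) (by norm_num)
  have h' := (abs_sub_le_iff.1 h).1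
  simp only [Finset.sum_range_succ, Finset.sum_range_zero, Nat.factorial, Nat.succ_eq_add_one,
    abs_of_nonneg h0] at h'
  norm_num at h'
  linarith

/-- `√3 ≤ 1.732051`. -/
theorem sqrt_three_le_bound : Real.sqrt 3 ≤ 1732051 / 1000000 := by
  rw [show (1732051 / 1000000 : ℝ) = Real.sqrt ((1732051 / 1000000) ^ 2) by
    rw [Real.sqrt_sq (by norm_num)]]
  exact Real.sqrt_le_sqrt (by norm_num)

/-- `√(2/3) ≤ 0.8165`. -/
theorem sqrt_two_thirds_le : Real.sqrt (2 / 3) ≤ 8165 / 10000 := by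
  rw [show (8165 / 10000 : ℝ) = Real.sqrt ((8165 / 10000) ^ 2) by
    rw [Real.sqrt_sq (by norm_num)]]
  exact Real.sqrt_le_sqrt (by norm_num)

/-! ### Lineage (B): the sharp `SU(2)` linear variance `v = 2` on the ball `‖B‖_op ≤ 1/4` -/

/-- **The sharp `SU(2)` variance of the linear one-link observables** (hypothesis-free, tree
`integral_var_tilted_le`): for `‖B‖_op ≤ b ≤ 1/4` (so `|2 Re tr(g B)| ≤ 1`) and every `Δ`,
`Var_{ν_B}(2 Re tr(g Δ)) ≤ ∫ (2 Re tr(g Δ))² dσ₂ ≤ 2 ‖Δ‖_F²` — the constant `v = 2` in place of the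
Poincaré-induced `8/3`. In 't Hooft units `b = 3β_W/2 ≤ 1/4` is `β_W ≤ 1/6`. -/
theorem su2_linVariance_sharp {b : ℝ} (hb : b ≤ 1 / 4) :
    ∀ B : Matrix (Fin 2) (Fin 2) ℂ, matrixOpNorm B ≤ b → ∀ Δ : Matrix (Fin 2) (Fin 2) ℂ,
      Var[fun g : Matrix.specialUnitaryGroup (Fin 2) ℂ =>
          ((2 : ℕ) : ℝ) * ((g : Matrix (Fin 2) (Fin 2) ℂ) * Δ).trace.re;
        (haarProbability (Matrix.specialUnitaryGroup (Fin 2) ℂ)).tilted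
          fun g => ((2 : ℕ) : ℝ) * ((g : Matrix (Fin 2) (Fin 2) ℂ) * B).trace.re] ≤ 2 * frobNorm Δ ^ 2 := by
  intro B hB Δ
  have h2 : ((2 : ℕ) : ℝ) = 2 := by norm_num
  simp only [h2]
  change Var[pot Δ; (haarProbability (Matrix.specialUnitaryGroup (Fin 2) ℂ)).tilted (pot B)] ≤ _
  have hB1 : ∀ g : Matrix.specialUnitaryGroup (Fin 2) ℂ, |pot B g| ≤ 1 := fun g => by
    simp only [pot]
    rw [abs_mul, abs_two]
    calc 2 * |((g : Matrix (Fin 2) (Fin 2) ℂ) * B).trace.re| ≤ 2 * (2 * matrixOpNorm B) :=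
          mul_le_mul_of_nonneg_left (abs_re_trace_su2_mul_le_opNorm g B) zero_le_two
      _ ≤ 1 := by linarith
  have hwm : Measurable (pot Δ) := (continuous_const.mul (continuous_re_trace_su_mul Δ)).measurable
  rw [variance_eq_integral hwm.aemeasurable]
  have hw2 : ∀ s : Matrix.specialUnitaryGroup (Fin 2) ℂ,
      pot Δ s ^ 2 = 4 * (((s : Matrix (Fin 2) (Fin 2) ℂ) * Δ).trace.re) ^ 2 := fun s => by
    simp only [pot]; ring
  calc ∫ s, (pot Δ s - ∫ s', pot Δ s' ∂((haarProbability _).tilted (pot B))) ^ 2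
          ∂((haarProbability _).tilted (pot B))
      ≤ ∫ s, pot Δ s ^ 2 ∂(haarProbability (Matrix.specialUnitaryGroup (Fin 2) ℂ)) :=
        integral_var_tilted_le B Δ hB1
    _ ≤ 2 * frobNorm Δ ^ 2 := by
        simp_rw [hw2]
        rw [integral_const_mul, integral_sq_re_trace_su2_mul]
        linarith [coef_sq_le Δ]

/-- **MASS GAP ON THE BALL FOR `SU(2)`, `d = 4`, SHARP LINEAGE (B)**, hypothesis-free: for `|β_W| ≤ 1/6`
and `3√3 |β_W| e^{ε₀} + e^{ε₀/2} √(2/3) ε₁ < 1`, `MassGapOnBallZd 4 2 (β_W/4) ε₀ ε₁ R` (pair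
`(c, v) = (2/3, 2)`, `√(c v) = 2/√3`; the row-sum formula vanishes at `β_W = √3/9 = 0.192…`, but the variance
input `su2_linVariance_sharp` is proved only on `‖B‖_op ≤ 1/4`, i.e. `|β_W| ≤ 1/6`, which is therefore the
range of this lineage; at `β_W = 1/6` it still carries `ε = 0.049`). -/
theorem su2_massGapOnBallZd_sharp {βW ε₀ ε₁ : ℝ} (R : ℝ) (hβ : |βW| ≤ 1 / 6)
    (hρ : 3 * Real.sqrt 3 * |βW| * exp ε₀ + exp (ε₀ / 2) * Real.sqrt (2 / 3) * ε₁ < 1) :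
    MassGapOnBallZd 4 2 (βW / 4) ε₀ ε₁ R := by
  have hc : (0 : ℝ) ≤ 2 / 3 := by norm_num
  have hb : |βW / 4| * (2 * (((4 : ℕ) : ℝ) - 1)) ≤ 1 / 4 := by
    rw [abs_div, abs_of_pos (by norm_num : (0 : ℝ) < 4)]
    norm_num
    linarith
  have hP : ∀ B : Matrix (Fin 2) (Fin 2) ℂ, matrixOpNorm B ≤ 1 / 4 →
      ∀ (ψ : Matrix.specialUnitaryGroup (Fin 2) ℂ → ℝ) (M : ℝ), 0 ≤ M →
        (∀ x y, |ψ x - ψ y| ≤ M * suFrobDist x y) →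
        Var[ψ; (haarProbability (Matrix.specialUnitaryGroup (Fin 2) ℂ)).tilted
          fun g => ((2 : ℕ) : ℝ) * ((g : Matrix (Fin 2) (Fin 2) ℂ) * B).trace.re] ≤ 2 / 3 * M ^ 2 :=
    fun B hB ψ M hM hψ => oneLinkPoincareSUN_two_sharp _ B hB ψ M hM hψ
  refine massGapOnBallZd_of_pair 4 2 (by norm_num) (by norm_num) R hc zero_le_two hb hP
    (su2_linVariance_sharp le_rfl) ?_
  have hsq : Real.sqrt (2 / 3 * 2) = 2 * Real.sqrt 3 / 3 := by
    have h3 : (2 * Real.sqrt 3 / 3) ^ 2 = 2 / 3 * 2 := by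
      rw [div_pow, mul_pow, Real.sq_sqrt (by norm_num)]; norm_num
    rw [← h3, Real.sqrt_sq (by positivity)]
  rw [hsq]
  have e : 6 * (((4 : ℕ) : ℝ) - 1) * |βW / 4| * (exp ε₀ * (2 * Real.sqrt 3 / 3)) =
      3 * Real.sqrt 3 * |βW| * exp ε₀ := by
    rw [abs_div, abs_of_pos (by norm_num : (0 : ℝ) < 4)]
    ring
  rw [e]
  exact hρ

/-! ### Certified rows, lineage (A): `ρ = 6 β_W e^{2ε} + √(2/3) e^{ε} ε < 1` -/

/-- Lineage-(A) row from numeric majorants: if `0 ≤ β_W`, `0 ≤ ε ≤ 1/2` and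
`6 β_W T(2ε) + 0.8165 T(ε) ε < 1` for the Taylor majorant `T`, then `MassGapOnBallZd 4 2 (β_W/4) (2ε) ε R`. -/
theorem su2_rowA {βW ε : ℝ} (R : ℝ) (hβ : 0 ≤ βW) (hε0 : 0 ≤ ε) (hε1 : ε ≤ 1 / 2)
    (h : 6 * βW * (1 + 2 * ε + (2 * ε) ^ 2 / 2 + (2 * ε) ^ 3 / 6 + 5 / 96 * (2 * ε) ^ 4) +
      (1 + ε + ε ^ 2 / 2 + ε ^ 3 / 6 + 5 / 96 * ε ^ 4) * (8165 / 10000) * ε < 1) :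
    MassGapOnBallZd 4 2 (βW / 4) (2 * ε) ε R := by
  refine su2_massGapOnBallZd_dim4 R ?_
  have h1 := exp_le_taylor4 (x := 2 * ε) (by linarith) (by linarith)
  have h2 := exp_le_taylor4 (x := ε) hε0 (by linarith)
  rw [abs_of_nonneg hβ, show 2 * ε / 2 = ε by ring]
  calc 6 * βW * exp (2 * ε) + exp ε * Real.sqrt (2 / 3) * ε
      ≤ 6 * βW * (1 + 2 * ε + (2 * ε) ^ 2 / 2 + (2 * ε) ^ 3 / 6 + 5 / 96 * (2 * ε) ^ 4) +
        (1 + ε + ε ^ 2 / 2 + ε ^ 3 / 6 + 5 / 96 * ε ^ 4) * (8165 / 10000) * ε := by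
        gcongr
        · exact sqrt_two_thirds_le
    _ < 1 := h

/-- Row (A): `(β⋆_W, ε) = (1/40, 0.470)`. -/
theorem su2_rowA_1_40 (R : ℝ) : MassGapOnBallZd 4 2 ((1 / 40 : ℝ) / 4) (2 * (47 / 100)) (47 / 100) R :=
  su2_rowA R (by norm_num) (by norm_num) (by norm_num) (by norm_num)

/-- Row (A): `(β⋆_W, ε) = (1/20, 0.346)`. -/
theorem su2_rowA_1_20 (R : ℝ) : MassGapOnBallZd 4 2 ((1 / 20 : ℝ) / 4) (2 * (173 / 500)) (173 / 500) R :=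
  su2_rowA R (by norm_num) (by norm_num) (by norm_num) (by norm_num)

/-- Row (A): `(β⋆_W, ε) = (1/16, 0.294)`. -/
theorem su2_rowA_1_16 (R : ℝ) : MassGapOnBallZd 4 2 ((1 / 16 : ℝ) / 4) (2 * (147 / 500)) (147 / 500) R :=
  su2_rowA R (by norm_num) (by norm_num) (by norm_num) (by norm_num)

/-- Row (A): `(β⋆_W, ε) = (1/12, 0.219)`. -/
theorem su2_rowA_1_12 (R : ℝ) : MassGapOnBallZd 4 2 ((1 / 12 : ℝ) / 4) (2 * (219 / 1000)) (219 / 1000) R :=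
  su2_rowA R (by norm_num) (by norm_num) (by norm_num) (by norm_num)

/-- Row (A): `(β⋆_W, ε) = (1/10, 0.167)`. -/
theorem su2_rowA_1_10 (R : ℝ) : MassGapOnBallZd 4 2 ((1 / 10 : ℝ) / 4) (2 * (167 / 1000)) (167 / 1000) R :=
  su2_rowA R (by norm_num) (by norm_num) (by norm_num) (by norm_num)

/-- Row (A): `(β⋆_W, ε) = (1/8, 0.097)`. -/
theorem su2_rowA_1_8 (R : ℝ) : MassGapOnBallZd 4 2 ((1 / 8 : ℝ) / 4) (2 * (97 / 1000)) (97 / 1000) R :=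
  su2_rowA R (by norm_num) (by norm_num) (by norm_num) (by norm_num)

/-- Row (A): `(β⋆_W, ε) = (3/20, 0.036)`. -/
theorem su2_rowA_3_20 (R : ℝ) : MassGapOnBallZd 4 2 ((3 / 20 : ℝ) / 4) (2 * (9 / 250)) (9 / 250) R :=
  su2_rowA R (by norm_num) (by norm_num) (by norm_num) (by norm_num)

/-! ### Certified rows, lineage (B): `ρ = 3√3 β_W e^{2ε} + √(2/3) e^{ε} ε < 1`, `β_W ≤ 1/6` -/

/-- Lineage-(B) row from numeric majorants (`√3 ≤ 1.732051`, `√(2/3) ≤ 0.8165`, Taylor `T`). -/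
theorem su2_rowB {βW ε : ℝ} (R : ℝ) (hβ : 0 ≤ βW) (hβ6 : βW ≤ 1 / 6) (hε0 : 0 ≤ ε) (hε1 : ε ≤ 1 / 2)
    (h : 3 * (1732051 / 1000000) * βW * (1 + 2 * ε + (2 * ε) ^ 2 / 2 + (2 * ε) ^ 3 / 6 + 5 / 96 * (2 * ε) ^ 4) +
      (1 + ε + ε ^ 2 / 2 + ε ^ 3 / 6 + 5 / 96 * ε ^ 4) * (8165 / 10000) * ε < 1) :
    MassGapOnBallZd 4 2 (βW / 4) (2 * ε) ε R := by
  refine su2_massGapOnBallZd_sharp R (by rw [abs_of_nonneg hβ]; exact hβ6) ?_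
  have h1 := exp_le_taylor4 (x := 2 * ε) (by linarith) (by linarith)
  have h2 := exp_le_taylor4 (x := ε) hε0 (by linarith)
  rw [abs_of_nonneg hβ, show 2 * ε / 2 = ε by ring]
  calc 3 * Real.sqrt 3 * βW * exp (2 * ε) + exp ε * Real.sqrt (2 / 3) * ε
      ≤ 3 * (1732051 / 1000000) * βW * (1 + 2 * ε + (2 * ε) ^ 2 / 2 + (2 * ε) ^ 3 / 6 + 5 / 96 * (2 * ε) ^ 4) +
        (1 + ε + ε ^ 2 / 2 + ε ^ 3 / 6 + 5 / 96 * ε ^ 4) * (8165 / 10000) * ε := by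
        gcongr
        · exact sqrt_three_le_bound
        · exact sqrt_two_thirds_le
    _ < 1 := h

/-- Row (B): `(β⋆_W, ε) = (1/20, 0.376)`. -/
theorem su2_rowB_1_20 (R : ℝ) : MassGapOnBallZd 4 2 ((1 / 20 : ℝ) / 4) (2 * (47 / 125)) (47 / 125) R :=
  su2_rowB R (by norm_num) (by norm_num) (by norm_num) (by norm_num) (by norm_num)

/-- Row (B): `(β⋆_W, ε) = (1/16, 0.328)`. -/
theorem su2_rowB_1_16 (R : ℝ) : MassGapOnBallZd 4 2 ((1 / 16 : ℝ) / 4) (2 * (41 / 125)) (41 / 125) R :=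
  su2_rowB R (by norm_num) (by norm_num) (by norm_num) (by norm_num) (by norm_num)

/-- Row (B): `(β⋆_W, ε) = (1/12, 0.258)`. -/
theorem su2_rowB_1_12 (R : ℝ) : MassGapOnBallZd 4 2 ((1 / 12 : ℝ) / 4) (2 * (129 / 500)) (129 / 500) R :=
  su2_rowB R (by norm_num) (by norm_num) (by norm_num) (by norm_num) (by norm_num)

/-- Row (B): `(β⋆_W, ε) = (1/10, 0.209)`. -/
theorem su2_rowB_1_10 (R : ℝ) : MassGapOnBallZd 4 2 ((1 / 10 : ℝ) / 4) (2 * (209 / 1000)) (209 / 1000) R :=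
  su2_rowB R (by norm_num) (by norm_num) (by norm_num) (by norm_num) (by norm_num)

/-- Row (B): `(β⋆_W, ε) = (1/8, 0.143)` — the HEADLINE single-link row (design D7: β⋆ ≥ half the Wilson
threshold of the door, largest ε there). -/
theorem su2_rowB_1_8 (R : ℝ) : MassGapOnBallZd 4 2 ((1 / 8 : ℝ) / 4) (2 * (143 / 1000)) (143 / 1000) R :=
  su2_rowB R (by norm_num) (by norm_num) (by norm_num) (by norm_num) (by norm_num)

/-- Row (B): `(β⋆_W, ε) = (3/20, 0.085)`. -/
theorem su2_rowB_3_20 (R : ℝ) : MassGapOnBallZd 4 2 ((3 / 20 : ℝ) / 4) (2 * (17 / 200)) (17 / 200) R :=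
  su2_rowB R (by norm_num) (by norm_num) (by norm_num) (by norm_num) (by norm_num)

/-- Row (B): `(β⋆_W, ε) = (1/6, 0.049)` — at the Poincaré-route Wilson threshold `1/6` of lineage (A)
the sharp lineage still carries a ball. -/
theorem su2_rowB_1_6 (R : ℝ) : MassGapOnBallZd 4 2 ((1 / 6 : ℝ) / 4) (2 * (49 / 1000)) (49 / 1000) R :=
  su2_rowB R (by norm_num) (by norm_num) (by norm_num) (by norm_num) (by norm_num)

end Summit.Ventures.YMGap.RobustBall
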